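import Literature.NumberTheory.Sieve.FriedlanderIwaniecPrimesJacobiTwistedSmoothing
import HarnessLib

/-!
# Friedlander–Iwaniec, *The polynomial `X² + Y⁴` captures its primes*, §12: collecting tools for
# Proposition 12.1 — the large-level regime and the re-indexing `r = c t`

[FI, §12, p. 50–51 of arXiv:math/9811185 = Ann. of Math. (2) 148 (1998), 945–1040].  Two pieces of
the final collection of Proposition 12.1 ((12.4)):

* `jtVflip_le_of_sq_le` — the regime `RS ≤ D`: taking `g = 0` and `a = 2S/R` in the smoothed excised
  inequality `jtVflip_le_smooth_excised` (the window `[2a, 2S/R]` where `g` must equal `1` is then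
  empty) the main term vanishes and the flipped form is `≤ (3D + 96RS(1 + log(1 + 32RS/D))
  + 96(RS)^{3/2}/D) ∑∑|α|² ≤ (435 D + 96(RS)^{3/2}/D) ∑∑|α|²`, inside the first and third terms of
  (12.4).
* `sum_Icc_sum_Ioc_div_le` — "summing over `m` and `c`": the change of variables `r = c t` turning
  `∑_{c ≤ R} ∑_{R/c < t ≤ 2R/c} h(c, ct)` into `≤ ∑_{R < r ≤ 2R} ∑_{c ∣ r} h(c, r)` for `h ≥ 0`, with the
  divisor facts `τ(r/c) ≤ τ(r)`, `∑_{m ∣ c} m ≤ c τ(c)` used to bound the weights.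

No definitions, no named facts (HOME/parity-ideate-lit/FI98-Prop121-MAP.md, step D-h of the g26
addendum).

## References

* J. Friedlander, H. Iwaniec, *The polynomial `X² + Y⁴` captures its primes*, Ann. of Math. (2) 148
  (1998), 945–1040, §12, (12.4), (12.17). [FriedlanderIwaniecAnnals1998]
-/

noncomputable section

open Finset Real Complex
open scoped NumberTheorySymbols ArithmeticFunction.sigma ComplexConjugate

namespace Literature.NumberTheory.Sieve.FriedlanderIwaniecPrimes

/-- **Re-indexing `r = c t`** ("summing over `m` and `c`"): for `h ≥ 0`,
`∑_{1 ≤ c ≤ R} ∑_{R/c < t ≤ 2R/c} h(c, ct) ≤ ∑_{R < r ≤ 2R} ∑_{c ∣ r} h(c, r)`.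
[cite: FriedlanderIwaniecAnnals1998, §12, after (12.17)] -/
theorem sum_Icc_sum_Ioc_div_le (R : ℕ) (h : ℕ → ℕ → ℝ) (hh : ∀ c r, 0 ≤ h c r) :
    ∑ c ∈ Icc 1 R, ∑ t ∈ Ioc (R / c) (2 * R / c), h c (c * t) ≤
      ∑ r ∈ Ioc R (2 * R), ∑ c ∈ r.divisors, h c r := by
  have step1 : ∀ c ∈ Icc 1 R, ∑ t ∈ Ioc (R / c) (2 * R / c), h c (c * t) ≤
      ∑ r ∈ (Ioc R (2 * R)).filter (fun r => c ∣ r), h c r := by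
    intro c hc
    have hc1 : 1 ≤ c := (mem_Icc.mp hc).1
    have hc0 : 0 < c := hc1
    rw [← sum_image (f := fun r => h c r) (s := Ioc (R / c) (2 * R / c)) (g := fun t => c * t)
      (fun x _ y _ hxy => Nat.eq_of_mul_eq_mul_left hc0 hxy)]
    refine sum_le_sum_of_subset_of_nonneg ?_ fun r _ _ => hh c r
    intro r hr
    rw [mem_image] at hr
    obtain ⟨t, ht, rfl⟩ := hr
    obtain ⟨ht1, ht2⟩ := mem_Ioc.mp ht
    rw [mem_filter, mem_Ioc]
    refine ⟨⟨?_, ?_⟩, dvd_mul_right c t⟩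
    · have h1 : R < R / c * c + c := Nat.lt_div_mul_add hc0
      have h2 : (R / c + 1) * c ≤ t * c := Nat.mul_le_mul_right c ht1
      have h3 : R / c * c + c = (R / c + 1) * c := by ring
      rw [mul_comm c t]; omega
    · calc c * t ≤ c * (2 * R / c) := Nat.mul_le_mul_left c ht2
        _ ≤ 2 * R := Nat.mul_div_le (2 * R) c
  calc ∑ c ∈ Icc 1 R, ∑ t ∈ Ioc (R / c) (2 * R / c), h c (c * t)
      ≤ ∑ c ∈ Icc 1 R, ∑ r ∈ (Ioc R (2 * R)).filter (fun r => c ∣ r), h c r := sum_le_sum step1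
    _ = ∑ c ∈ Icc 1 R, ∑ r ∈ Ioc R (2 * R), if c ∣ r then h c r else 0 := by
        simp_rw [sum_filter]
    _ = ∑ r ∈ Ioc R (2 * R), ∑ c ∈ Icc 1 R, if c ∣ r then h c r else 0 := sum_comm
    _ = ∑ r ∈ Ioc R (2 * R), ∑ c ∈ (Icc 1 R).filter (fun c => c ∣ r), h c r := by
        simp_rw [sum_filter]
    _ ≤ ∑ r ∈ Ioc R (2 * R), ∑ c ∈ r.divisors, h c r := by
        refine sum_le_sum fun r hr => sum_le_sum_of_subset_of_nonneg ?_ fun c _ _ => hh c r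
        intro c hc
        rw [mem_filter] at hc
        have hr0 : r ≠ 0 := by have := (mem_Ioc.mp hr).1; omega
        exact Nat.mem_divisors.mpr ⟨hc.2, hr0⟩

/-- `τ(r/c) ≤ τ(r)` for `c ∣ r`, `r ≠ 0` (used in "summing over `m` and `c`").
[cite: FriedlanderIwaniecAnnals1998, §12, after (12.17)] -/
theorem sigma_zero_div_le {r c : ℕ} (hr : r ≠ 0) (hc : c ∣ r) : σ 0 (r / c) ≤ σ 0 r := by
  rw [ArithmeticFunction.sigma_zero_apply, ArithmeticFunction.sigma_zero_apply]
  exact card_le_card (Nat.divisors_subset_of_dvd hr (Nat.div_dvd_of_dvd hc))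

/-- `∑_{m ∣ c} m ≤ c τ(c)` (used in "summing over `m` and `c`").
[cite: FriedlanderIwaniecAnnals1998, §12, after (12.17)] -/
theorem sum_divisors_cast_le (c : ℕ) : ∑ m ∈ c.divisors, (m : ℝ) ≤ (c : ℝ) * (σ 0 c : ℕ) := by
  rw [ArithmeticFunction.sigma_zero_apply]
  calc ∑ m ∈ c.divisors, (m : ℝ) ≤ ∑ m ∈ c.divisors, (c : ℝ) := by
        refine sum_le_sum fun m hm => ?_
        exact_mod_cast Nat.divisor_le hm
    _ = (c : ℝ) * (#c.divisors : ℕ) := by rw [sum_const, nsmul_eq_mul]; ring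

/-- `∑_{m ∣ c} w(m) ≤ τ(c) · B` when `w ≤ B` on divisors (used in "summing over `m` and `c`").
[cite: FriedlanderIwaniecAnnals1998, §12, after (12.17)] -/
theorem sum_divisors_le_card_mul {c : ℕ} {w : ℕ → ℝ} {B : ℝ} (hw : ∀ m ∈ c.divisors, w m ≤ B) :
    ∑ m ∈ c.divisors, w m ≤ ((σ 0 c : ℕ) : ℝ) * B := by
  rw [ArithmeticFunction.sigma_zero_apply]
  calc ∑ m ∈ c.divisors, w m ≤ ∑ m ∈ c.divisors, B := sum_le_sum hw
    _ = (#c.divisors : ℕ) * B := by rw [sum_const, nsmul_eq_mul]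

/-- **The regime `RS ≤ D`** [FI, §12]: for `S ≥ 1`, `R ≥ 1`, `D ≥ 1` with `RS ≤ D` and `α` supported
on `(r, s) = 1`, the flipped form of Proposition 12.1 over `D < d ≤ 2D` is
`≤ (435 D + 96 (RS)^{3/2}/D) ∑∑ |α_{rs}|²` (the smoothed excised inequality with `g = 0`: only the
excised near-diagonal strip and the level-`> D` count remain).
[cite: FriedlanderIwaniecAnnals1998, §12, (12.4) first and third terms] -/
theorem jtVflip_le_of_mul_le {D R S : ℕ} (hS : 1 ≤ S) (hR : 1 ≤ R) (hD : 1 ≤ D) (hRS : R * S ≤ D)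
    (α : ℕ → ℕ → ℂ) (hα : ∀ r s, α r s ≠ 0 → r.Coprime s) :
    ∑ d ∈ Ioc D (2 * D), ∑ a' ∈ range d, ‖∑ r ∈ Ioc R (2 * R), ∑ s ∈ Ioc S (2 * S),
        (if r.Coprime d ∧ (d : ℤ) ∣ (s : ℤ) - (a' : ℤ) * r then α r s * (J((d : ℤ) | r) : ℂ)
          else 0)‖ ^ 2 ≤
      (435 * D + 96 * ((R : ℝ) * S) ^ (3 / 2 : ℝ) / D) *
        ∑ r ∈ Ioc R (2 * R), ∑ s ∈ Ioc S (2 * S), ‖α r s‖ ^ 2 := by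
  -- a weight `F`: the indicator of `[1, 2]` will do (only its vanishing/normalisation matter here)
  set F : ℝ → ℝ := fun w => if w ∈ Set.Icc (1 : ℝ) 2 then 1 else 0 with hF
  have hF0 : ∀ w, 0 ≤ F w := fun w => by rw [hF]; simp only; split_ifs <;> norm_num
  have hF1 : ∀ w, F w ≤ 1 := fun w => by rw [hF]; simp only; split_ifs <;> norm_num
  have hF2 : ∀ w ∈ Set.Icc (1 : ℝ) 2, F w = 1 := fun w hw => by rw [hF]; simp only; rw [if_pos hw]
  have hF3 : ∀ w, w ≤ 1 / 2 → F w = 0 := fun w hw => by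
    rw [hF]; simp only; rw [if_neg]; intro h; exact absurd h.1 (by linarith)
  have hF4 : ∀ w, 5 / 2 ≤ w → F w = 0 := fun w hw => by
    rw [hF]; simp only; rw [if_neg]; intro h; exact absurd h.2 (by linarith)
  have hR0 : (0 : ℝ) < R := by exact_mod_cast hR
  have hS0 : (0 : ℝ) < S := by exact_mod_cast hS
  have hD0 : (0 : ℝ) < D := by exact_mod_cast hD
  have ha : (0 : ℝ) < 2 * S / R := by positivity
  have h := jtVflip_le_smooth_excised (N := 2 * D) hS le_rfl α hα F hF0 hF1 hF2 hF3 hF4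
    (fun _ => (0 : ℝ)) (fun _ => le_rfl) (fun _ => zero_le_one) ha
    (fun x h1 h2 => absurd (h1.trans h2) (by linarith))
  refine h.trans ?_
  -- the main term vanishes (`g = 0`)
  have hmain : ∑ d ∈ Ioc 0 (2 * D), (F ((d : ℝ) / D) : ℂ) * ∑ r₁ ∈ Ioc R (2 * R),
      ∑ s₁ ∈ Ioc S (2 * S), ∑ r₂ ∈ Ioc R (2 * R), ∑ s₂ ∈ Ioc S (2 * S),
        (if (d : ℤ) ∣ (r₁ : ℤ) * s₂ - (r₂ : ℤ) * s₁ then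
          α r₁ s₁ * conj (α r₂ s₂) * (J((d : ℤ) | r₁ * r₂) : ℂ) *
            (((fun _ : ℝ => (0 : ℝ)) |(s₁ : ℝ) / r₁ - (s₂ : ℝ) / r₂| : ℝ) : ℂ) else 0) = 0 := by
    refine sum_eq_zero fun d _ => ?_
    rw [mul_eq_zero]; right
    refine sum_eq_zero fun _ _ => sum_eq_zero fun _ _ => sum_eq_zero fun _ _ =>
      sum_eq_zero fun _ _ => ?_
    simp
  rw [hmain, norm_zero, zero_add]
  refine mul_le_mul_of_nonneg_right ?_ (sum_nonneg fun _ _ => sum_nonneg fun _ _ => sq_nonneg _)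
  -- the excision constant with `a = 2S/R`, `RS ≤ D`
  have hRS : (R : ℝ) * S ≤ D := by exact_mod_cast hRS
  have hRS1 : (1 : ℝ) ≤ (R : ℝ) * S := by
    have h1 : (1 : ℝ) ≤ R := by exact_mod_cast hR
    have h2 : (1 : ℝ) ≤ S := by exact_mod_cast hS
    nlinarith
  have e1 : 48 * (2 * (S : ℝ) / R) * (R : ℝ) ^ 2 = 96 * ((R : ℝ) * S) := by
    field_simp
    ring
  have e2 : 16 * (R : ℝ) ^ 2 * (2 * (S : ℝ) / R) / D = 32 * ((R : ℝ) * S) / D := by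
    field_simp
    ring
  rw [e1, e2]
  have hlog : Real.log (1 + 32 * ((R : ℝ) * S) / D) ≤ 7 / 2 := by
    have h1 : 1 + 32 * ((R : ℝ) * S) / D ≤ 33 := by
      have : 32 * ((R : ℝ) * S) / D ≤ 32 := by
        rw [div_le_iff₀ hD0]; nlinarith
      linarith
    calc Real.log (1 + 32 * ((R : ℝ) * S) / D) ≤ Real.log 33 :=
          Real.log_le_log (by positivity) h1
      _ ≤ 7 / 2 := by
          rw [Real.log_le_iff_le_exp (by norm_num)]
          have h7 : (33 : ℝ) ≤ Real.exp 1 ^ (7 / 2 : ℝ) := by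
            have he : (2.7182818283 : ℝ) < Real.exp 1 := Real.exp_one_gt_d9
            have h49 : (33 : ℝ) ^ (2 : ℝ) ≤ (2.7182818283 : ℝ) ^ (7 : ℝ) := by norm_num
            have h33 : (33 : ℝ) = ((33 : ℝ) ^ (2 : ℝ)) ^ (1 / 2 : ℝ) := by
              rw [← Real.rpow_mul (by norm_num)]; norm_num
            rw [h33, show (7 / 2 : ℝ) = 7 * (1 / 2) by norm_num, Real.rpow_mul (by positivity)]
            exact Real.rpow_le_rpow (by positivity)
              (h49.trans (Real.rpow_le_rpow (by norm_num) he.le (by norm_num))) (by norm_num)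
          rwa [← Real.exp_one_rpow]
  have hsq : Real.sqrt ((R : ℝ) * S) = ((R : ℝ) * S) ^ (1 / 2 : ℝ) := Real.sqrt_eq_rpow _
  have e3 : 3 * (32 * ((R : ℝ) * S) / D) * Real.sqrt ((R : ℝ) * S) =
      96 * ((R : ℝ) * S) ^ (3 / 2 : ℝ) / D := by
    rw [hsq, show (3 / 2 : ℝ) = 1 + 1 / 2 by norm_num,
      Real.rpow_add (by positivity), Real.rpow_one]
    ring
  rw [e3]
  have hmid : 96 * ((R : ℝ) * S) * (1 + Real.log (1 + 32 * ((R : ℝ) * S) / D)) ≤ 432 * D := by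
    have h1 : 1 + Real.log (1 + 32 * ((R : ℝ) * S) / D) ≤ 9 / 2 := by linarith
    have h0 : 0 ≤ 1 + Real.log (1 + 32 * ((R : ℝ) * S) / D) := by
      have : 0 ≤ Real.log (1 + 32 * ((R : ℝ) * S) / D) := Real.log_nonneg (by
        have : 0 ≤ 32 * ((R : ℝ) * S) / D := by positivity
        linarith)
      linarith
    nlinarith
  linarith

end Literature.NumberTheory.Sieve.FriedlanderIwaniecPrimes
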